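import Summits.Parity.BatemanHorn.Theorems.RoughValueTransportBalancedSemiprimeLayerRoughWindowLever
import HarnessLib

/-!
# Route `RoughValueTransport`, crux `BalancedSemiprimeLayer` (stmt-Parity-9469), line `Ideator4Sketch`
# (card `relative-mass-split`): stub S3 `stub_relativeLeverOfStep` — the RELATIVE lever

The relative twin of the landed lever `lever_of_anchors` / `stub_roughWindowLever`
(`Theorems/RoughValueTransportBalancedSemiprimeLayerRoughWindowLever.lean`).  There the sifted pair count
`S` of coordinate `i` is bounded (anchor E) by `(1 + C_FL)·(x·Σ_m ρᵢ(m)/m)·V(x^c) + (absolute remainders)`;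
HERE the sieve step is booked against the ACTUAL window mass `X = Σ_{m ∈ roughDivWindow dᵢ δ c x} P(x; m, 1)`
(`P = windowPairCount`): the first hypothesis (the statement of stub S1 `stub_relativeSiftedLe`, verbatim)
reads `S ≤ (1 + C_FL)·X·V(x^c) + R_rel` with
`R_rel = Σ_{1 ≤ e ≤ x^c, e squarefree} |Σ_m (P(x; m, e) − (ρ_F(e)/e)·P(x; m, 1))|`, and the per-coordinate
hypothesis (the "system relative form") supplies `c₀ > 0` and, for every `0 < c ≤ c₀`, a constant `C`
such that for every `0 < δ ≤ c` some `η > 0` makes, eventually in `x`, BOTH `X ≤ C·δ·x` AND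
`R_rel ≤ x^{1−η}`.  Conclusion: `CoordLayerThin f i` (for every `ε > 0` some `δ ∈ (0, 1/4]` gives
`E_{f,i}(x, δ) ≤ ε·x/(log x)^k` eventually).

Assembly (paper): given `ε > 0` take `c = min(c₀, 1/4)`, the constants `C` (relative form at `c`),
`K` (anchor D `stub_densityProduct_le`: `V(x^c) ≤ K/(log x)^k`), `C_FL` (hypothesis S1), put
`L = 2(1 + C_FL)·K·(|C| + 1)` and `δ = min(c, ε/L)`; eventually in `x`, by the injection anchor C
`stub_coordLayer_le_sifted`,
`E_{f,i}(x, δ) ≤ dᵢ + S ≤ dᵢ + (1 + C_FL)·(|C| + 1)·δ·x·K/(log x)^k + x^{1−η'} ≤ ε·x/(log x)^k`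
(`η' = min(η, 1/2)`, absorption `eventually_const_add_rpow_le`).  Nothing is assumed beyond the tree and
the two displayed hypotheses.  Reference for the mechanism: C. Hooley, Acta Math. 117 (1967) 281–299.
-/

noncomputable section

open Polynomial Filter Finset
open Literature.NumberTheory.Sieve
open scoped BigOperators

namespace Summit.Parity.BatemanHorn.Cruxes.BalancedSemiprimeLayer.RelativeMassSplit

open Summit.Parity.BatemanHorn.Cruxes.BalancedSemiprimeLayer.RoughRelaxedDivisorSieve
open Summit.Parity.BatemanHorn.Cruxes.BalancedSemiprimeLayer.SmoothModulusTwistedHooley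
  (coordLayer CoordLayerThin)
open Summit.Parity.BatemanHorn.Theorems.BalancedSemiprimeLayer.Negative
  (natDegree_pos_of_isBatemanHornSystem)

/-- **S3 `stub_relativeLeverOfStep` — the relative lever, from the relative sieve step** (registered stub
of the skeleton of line `Ideator4Sketch` = card `relative-mass-split`, crux `BalancedSemiprimeLayer`).
Given the statement of S1 (first hypothesis, verbatim: the `k`-dimensional sieve step booked against the
actual window mass `X = Σ_m P(x; m, 1)`), for every Bateman–Horn system `f` and coordinate `i`: the system
relative form (actual mass `X ≤ C·δ·x`, relative remainders `≤ x^{1−η}` at level `x^c`, for all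
`0 < c ≤ c₀` and `0 < δ ≤ c`) implies `CoordLayerThin f i`.  Proof: the chain of `lever_of_anchors` with
anchor B and the Type-I input replaced by the two clauses of the hypothesis — `c = min(c₀, 1/4)`, `K` from
`stub_densityProduct_le`, injection `stub_coordLayer_le_sifted`, `δ = min(c, ε/(2(1 + C_FL)·K·(|C| + 1)))`,
absorption `eventually_const_add_rpow_le`. [folklore] -/
theorem stub_relativeLeverOfStep :
    (∀ (k : ℕ) (f : Fin k → ℤ[X]), IsBatemanHornSystem f → ∃ CFL : ℝ, 0 ≤ CFL ∧
      ∀ (i : Fin k) (c δ : ℝ), 0 < c → 0 < δ → ∀ x : ℕ, (2 : ℝ) ≤ (x : ℝ) ^ c →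
        (∑ m ∈ roughDivWindow (f i).natDegree δ c x,
            (#((posRange f x).filter (fun n : ℕ => ((m : ℤ) ∣ (f i).eval (n : ℤ)) ∧
                ((∏ j, f j).eval (n : ℤ)).natAbs.Coprime (primesProdBelow ((x : ℝ) ^ c)))) : ℝ)) ≤
          (1 + CFL) * (∑ m ∈ roughDivWindow (f i).natDegree δ c x, (windowPairCount f i x m 1 : ℝ)) *
            (∏ p ∈ Nat.primesBelow ⌈(x : ℝ) ^ c⌉₊, (1 - (polyRootCountMod f p : ℝ) / p)) +
          ∑ e ∈ (Icc 1 ⌊(x : ℝ) ^ c⌋₊).filter Squarefree,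
            |∑ m ∈ roughDivWindow (f i).natDegree δ c x,
              ((windowPairCount f i x m e : ℝ) -
                (polyRootCountMod f e : ℝ) / e * (windowPairCount f i x m 1 : ℝ))|) →
    ∀ (k : ℕ) (f : Fin k → ℤ[X]), IsBatemanHornSystem f → ∀ i : Fin k,
      (∃ c₀ : ℝ, 0 < c₀ ∧ ∀ c : ℝ, 0 < c → c ≤ c₀ → ∃ C : ℝ, ∀ δ : ℝ, 0 < δ → δ ≤ c →
        ∃ η : ℝ, 0 < η ∧ ∀ᶠ x : ℕ in atTop,
          (∑ m ∈ roughDivWindow (f i).natDegree δ c x, (windowPairCount f i x m 1 : ℝ)) ≤ C * δ * x ∧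
          (∑ e ∈ (Icc 1 ⌊(x : ℝ) ^ c⌋₊).filter Squarefree,
            |∑ m ∈ roughDivWindow (f i).natDegree δ c x,
              ((windowPairCount f i x m e : ℝ) -
                (polyRootCountMod f e : ℝ) / e * (windowPairCount f i x m 1 : ℝ))|) ≤ (x : ℝ) ^ (1 - η)) →
      CoordLayerThin f i := by
  intro hS1 k f hf i hRel ε hε
  -- ## the exponent `c`
  obtain ⟨c₀, hc₀, hRel⟩ := hRel
  set c : ℝ := min c₀ (1 / 4) with hcdef
  have hc0 : 0 < c := lt_min hc₀ (by norm_num)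
  have hcc₀ : c ≤ c₀ := min_le_left _ _
  have hc4 : c ≤ 1 / 4 := min_le_right _ _
  have hc38 : c < 3 / 8 := by linarith
  -- ## the constants: `C` (relative form at `c`), `K` (anchor D), `C_FL` (hypothesis S1)
  obtain ⟨C, hC⟩ := hRel c hc0 hcc₀
  obtain ⟨K, hK0, hDx⟩ := stub_densityProduct_le k f hf c hc0
  obtain ⟨CFL, hCFL0, hEx⟩ := hS1 k f hf
  -- ## the choice of `δ`
  set L : ℝ := 2 * (1 + CFL) * K * (|C| + 1) with hL
  have hL0 : 0 < L := by positivity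
  set δ : ℝ := min c (ε / L) with hδdef
  have hδ0 : 0 < δ := lt_min hc0 (div_pos hε hL0)
  have hδc : δ ≤ c := min_le_left _ _
  have hδ4 : δ ≤ 1 / 4 := hδc.trans hc4
  have hδL : δ * L ≤ ε := by
    have := min_le_right c (ε / L)
    rwa [← hδdef, le_div_iff₀ hL0] at this
  refine ⟨δ, hδ0, hδ4, ?_⟩
  -- ## the eventual inputs
  obtain ⟨η, hη, hTx⟩ := hC δ hδ0 hδc
  set η' : ℝ := min η (1 / 2) with hη'
  have hη'0 : 0 < η' := lt_min hη (by norm_num)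
  have hη'1 : η' ≤ 1 := (min_le_right _ _).trans (by norm_num)
  have hηη' : η' ≤ η := min_le_left _ _
  have hCx := stub_coordLayer_le_sifted k f hf i c δ hc0 hc38 hδ0 hδ4
  have hz2 : ∀ᶠ x : ℕ in atTop, (2 : ℝ) ≤ (x : ℝ) ^ c :=
    ((tendsto_rpow_atTop hc0).comp tendsto_natCast_atTop_atTop).eventually_ge_atTop _
  have habs := eventually_const_add_rpow_le hη'0 hη'1 (half_pos hε) ((f i).natDegree : ℝ) k
  have hlog : ∀ᶠ x : ℕ in atTop, (1 : ℝ) < x := by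
    exact_mod_cast eventually_gt_atTop 1
  filter_upwards [hTx, hCx, hDx, hz2, habs, hlog] with x hTx hCx hDx hz2 habs hx1
  have hEx' := hEx i c δ hc0 hδ0 x hz2
  obtain ⟨hXx, hRx⟩ := hTx
  -- ## the chain of inequalities
  have hx0 : (0 : ℝ) < x := by linarith
  have hlogpos : 0 < Real.log x := Real.log_pos hx1
  have hlk : 0 < Real.log (x : ℝ) ^ k := pow_pos hlogpos k
  set Xm := ∑ m ∈ roughDivWindow (f i).natDegree δ c x, (windowPairCount f i x m 1 : ℝ) with hXm
  set V := ∏ p ∈ Nat.primesBelow ⌈(x : ℝ) ^ c⌉₊, (1 - (polyRootCountMod f p : ℝ) / p) with hV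
  set Rm := ∑ e ∈ (Icc 1 ⌊(x : ℝ) ^ c⌋₊).filter Squarefree,
    |∑ m ∈ roughDivWindow (f i).natDegree δ c x,
      ((windowPairCount f i x m e : ℝ) -
        (polyRootCountMod f e : ℝ) / e * (windowPairCount f i x m 1 : ℝ))| with hRm
  have hRx' : Rm ≤ (x : ℝ) ^ (1 - η') :=
    hRx.trans (Real.rpow_le_rpow_of_exponent_le hx1.le (by linarith))
  have hV0 : 0 ≤ V := by
    refine Finset.prod_nonneg fun p hp => sub_nonneg.mpr ?_
    have hpp := Nat.prime_of_mem_primesBelow hp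
    have hp0 : (0 : ℝ) < p := by exact_mod_cast hpp.pos
    rw [div_le_one hp0]
    exact_mod_cast polyRootCountMod_le f p
  -- the actual mass: `X ≤ C·δ·x ≤ (|C| + 1)·δ·x`
  have hXle : Xm ≤ (|C| + 1) * δ * x := by
    have hδx : 0 ≤ δ * (x : ℝ) := by positivity
    have hCabs : C ≤ |C| + 1 := (le_abs_self C).trans (by linarith)
    calc Xm ≤ C * δ * x := hXx
      _ = C * (δ * x) := by ring
      _ ≤ (|C| + 1) * (δ * x) := mul_le_mul_of_nonneg_right hCabs hδx
      _ = (|C| + 1) * δ * x := by ring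
  -- main term: (1+CFL)·X·V ≤ (1+CFL)·(|C|+1)·δ·x·K/(log x)^k = (δL/2)·x/(log x)^k
  have hmain : (1 + CFL) * Xm * V ≤ (δ * L / 2) * (x : ℝ) / Real.log x ^ k := by
    have h2 : (1 + CFL) * Xm * V ≤
        (1 + CFL) * ((|C| + 1) * δ * x) * (K / Real.log x ^ k) :=
      mul_le_mul (mul_le_mul_of_nonneg_left hXle (by positivity)) hDx hV0 (by positivity)
    refine h2.trans (le_of_eq ?_)
    rw [hL]
    field_simp
  calc (coordLayer f i δ x : ℝ)
      ≤ ((f i).natDegree : ℝ) + ∑ m ∈ roughDivWindow (f i).natDegree δ c x,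
          (#((posRange f x).filter (fun n : ℕ => ((m : ℤ) ∣ (f i).eval (n : ℤ)) ∧
              ((∏ j, f j).eval (n : ℤ)).natAbs.Coprime (primesProdBelow ((x : ℝ) ^ c)))) : ℝ) := hCx
    _ ≤ ((f i).natDegree : ℝ) + ((1 + CFL) * Xm * V + Rm) := by gcongr
    _ ≤ ((f i).natDegree : ℝ) + ((δ * L / 2) * (x : ℝ) / Real.log x ^ k + (x : ℝ) ^ (1 - η')) := by
        gcongr
    _ = (((f i).natDegree : ℝ) + (x : ℝ) ^ (1 - η')) + (δ * L / 2) * (x : ℝ) / Real.log x ^ k := by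
        ring
    _ ≤ ε / 2 * (x : ℝ) / Real.log x ^ k + (ε / 2) * (x : ℝ) / Real.log x ^ k :=
        add_le_add habs (div_le_div_of_nonneg_right
          (mul_le_mul_of_nonneg_right (by linarith) hx0.le) hlk.le)
    _ = ε * (x : ℝ) / Real.log x ^ k := by ring

end Summit.Parity.BatemanHorn.Cruxes.BalancedSemiprimeLayer.RelativeMassSplit

end
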